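/-
Copyright (c) 2026 the pub-hodgecm-mathlib formalisation cell (harness21).  Prover seat hodgecm-mathlib-K2E3-p03 (g7), HCML Track B «K2-LIT»,
h413 = `stmt-HodgeConjecture-24833`, road (11-3-split-nsc), leaf (CELL-3) `sig_K2E3GL3PrincipalSeriesThreeCell` (U12 ED. 31 :479): the PAYER FILE of the weak
3-cell lemma — both maximal parabolics, modulo the two analytic cell letters L1 (middle) ∕ L2 (open) (E4b, K2 bus 2026-09-04 12:13Z ∕ 12:21Z).  2026-09-04.
-/
import Summits.HodgeConjecture.HodgeConjecture.Theorems.K2E3GL3WeakCellLemma                      -- (E4b-3) (this seat) ★ p860183: dévissage assembly + glue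
import Summits.HodgeConjecture.HodgeConjecture.Theorems.K2E3GL3BorelInducedJacquetQClosedCellGL2   -- ★ (E4b-1α′) p860082 `exists_closedCellMap_blockMap` (pays L0)
import Summits.HodgeConjecture.HodgeConjecture.Theorems.K2E3GL3WeakCellLemmaTransport             -- ★ (E4b-T) p860074 `ncq_jacquetGL_oneTwo_of_twoOne`
import Summits.HodgeConjecture.HodgeConjecture.Theorems.K2E3GL3BorelInducedJacquetQMiddleCell   -- ★ (E4b-1β) p860371 `exists_middleCellMap` (pays L1; ED. 2)
import Summits.HodgeConjecture.HodgeConjecture.Theorems.K2E3GL3BorelInducedJacquetQOpenCell     -- ★ (E4b-1γ) `openCell_letter` (pays L2; ED. 2)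
import HarnessLib

/-!
# K2_E3 road (h413), leaf (CELL-3) — the weak 3-cell lemma `sig_K2E3GL3PrincipalSeriesThreeCell` for BOTH two-block parabolics of `GL₃(F)`, modulo the middle
# and open `(B, P_{(2,1)})`-cell letters

Cell `pub/hodgecm-mathlib` (D-0151), Track B, seat K2E3-p03 (g7) (payer of (CELL-3) per dealer K2E3-plan (g4), U12 ED. 31).  `--supports stmt-HodgeConjecture-24833
--as helper`; THEOREMS ONLY (no `def`, no instance, no notation, no named fact, no `sorry`); never imports `Cruxes/…/Lines`.  COUNT-NEUTRAL.  HYPOTHESIS-FIRST on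
exactly the two analytic cell letters `L1` (middle cell, (E4b-1β) K2E3-p21 (g7)) and `L2` (open cell, (E4b-1γ) K2E3-p25 (g2)); the closed-cell letter `L0` is
DISCHARGED here by ★ (E4b-1α′) and the `P_{(1,2)}` half by ★ (E4b-T).

THE MATHEMATICS ([BernsteinZelevinsky1977, Thm. 5.2, §2.3]; [Casselman1995, Cor. 5.4.3, §6.3]; [Zelevinsky1980, §1.1]).  For a character `χ` of the diagonal torus of
`GL₃(F)` and `I(χ) = Ind_B(χδ_B^{1/2})`:
* `closedCell_letter` — L0 holds: ★ `exists_closedCellMap_blockMap` gives `Ψ₀ : r_{(2,1)}(I(χ)) → I₂(χ₂)` with `Ψ₀[f](g) = f(diag(ι g))`, `GL₂`-equivariant,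
  `ker Ψ₀ = J_P`; L0 keeps the equivariance and `ker Ψ₀ ⊆ J_P`.
* `ncq_jacquetGL_twoOne_of_middle_of_open` — the `P_{(2,1)}` half from L1, L2 (★ E4b-3 `ncq_jacquetGL_twoOne_of_cellMaps`).
* `ncq_jacquetGL_oneTwo_of_middle_of_open` — the `P_{(1,2)}` half: ★ E4b-T transports the `(2,1)` statement for ALL `χ′` along the outer automorphism
  `g ↦ w₀ ᵗg⁻¹ w₀` (which swaps `P_{(2,1)}` and `P_{(1,2)}` and sends `I(χ′)` to `I(χ′^θ)`).
* **`principalSeriesThreeCell_of_middle_of_open`** — the statement of the socket `sig_K2E3GL3PrincipalSeriesThreeCell` (★ E4a's `h3cell` binder, χ-form) for the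
  field `F`, from `L1`, `L2` for all `χ′` (★ glue `h3cell_of_twoOne_of_oneTwo`).  ED. 2 (once (E4b-1β)∕(E4b-1γ) are ★) appends the letter-free payer
  `principalSeriesThreeCell` with the socket's bytes.

HONEST LABEL: HC_CM is proved only modulo the 7 printed citations (2 remaining named inputs: hLiu418 = stmt-HodgeConjecture-24832, h413 = stmt-HodgeConjecture-24833) until rung 0
closes; count-neutral helper; CONDITIONAL on the two cell letters L1, L2 (binders, stated not assumed as facts).

## Mathlib ∕ tree search
★ `ncq_jacquetGL_twoOne_of_cellMaps`, ★ `h3cell_of_twoOne_of_oneTwo` (K2E3GL3WeakCellLemma); ★ `exists_closedCellMap_blockMap` (K2E3GL3BorelInducedJacquetQClosedCellGL2);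
★ `ncq_jacquetGL_oneTwo_of_twoOne` (K2E3GL3WeakCellLemmaTransport).  Dedup: `rg "principalSeriesThreeCell|closedCell_letter"` — only the socket in `Cruxes/…/Lines` (not imported).

## References
* [BernsteinZelevinsky1977] I. N. Bernstein, A. V. Zelevinsky, *Induced representations of reductive p-adic groups I*, Ann. Sci. ÉNS 10 (1977), §2.3, Thm. 5.2.
* [Casselman1995] W. Casselman, *Introduction to the theory of admissible representations of p-adic reductive groups* (draft 1995), Cor. 5.4.3, §6.3.
* [Zelevinsky1980] A. V. Zelevinsky, *Induced representations of reductive p-adic groups II*, Ann. Sci. ÉNS 13 (1980), §1.1.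
-/

set_option autoImplicit false
set_option linter.dupNamespace false

noncomputable section

open Function Representation
open scoped MatrixGroups
open Literature.NumberTheory.Automorphic
open Summit.HodgeConjecture.HodgeConjecture.Cruxes.H413.K2E3GL3WeakCellLemma

namespace Summit.HodgeConjecture.HodgeConjecture.Cruxes.H413.K2E3GL3PrincipalSeriesThreeCell

variable {F : Type} [Field F] [ValuativeRel F] [TopologicalSpace F] [IsNonarchimedeanLocalField F]

/-- **The closed-cell letter L0 of ★ E4b-3 holds** (★ (E4b-1α′) `exists_closedCellMap_blockMap`: the restriction `Ψ₀[f](g) = f(diag(ι g))` is `GL₂`-equivariant into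
`I₂(χ₂)` with kernel exactly `J_P`; L0 keeps one direction). [cite: BernsteinZelevinsky1977, Thm. 5.2] [cite: Casselman1995, §6.3, Prop. 6.3.1] -/
theorem closedCell_letter (χ : (Π a : Fin 3, GL {i : Fin 3 // (id : Fin 3 → Fin 3) i = a} F) →* ℂˣ) :
    ∀ ι : GL (Fin 2) F →* (Π a, GL {i // (![0, 0, 1] : Fin 3 → Fin 2) i = a} F),
    (∀ g : GL (Fin 2) F, ((blockDiagonalGL F (![0, 0, 1] : Fin 3 → Fin 2) (ι g) : GL (Fin 3) F) : Matrix (Fin 3) (Fin 3) F) =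
    !![(g : Matrix (Fin 2) (Fin 2) F) 0 0, (g : Matrix (Fin 2) (Fin 2) F) 0 1, 0;
    (g : Matrix (Fin 2) (Fin 2) F) 1 0, (g : Matrix (Fin 2) (Fin 2) F) 1 1, 0;
    0, 0, 1]) → Continuous ι →
    ∃ (χ₂ : (Π a : Fin 2, GL {i : Fin 2 // (id : Fin 2 → Fin 2) i = a} F) →* ℂˣ)
    (Ψ : (restrictUnipotentGL F (![0, 0, 1] : Fin 3 → Fin 2) (parabolicIndGL F (id : Fin 3 → Fin 3)
    ((Representation.trivial ℂ (Π a : Fin 3, GL {i : Fin 3 // (id : Fin 3 → Fin 3) i = a} F) ℂ).twist χ))).Coinvariants →ₗ[ℂ]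
    SmoothInd (standardParabolicGL F (id : Fin 2 → Fin 2))
    (Representation.twist (((Representation.trivial ℂ (Π a : Fin 2, GL {i : Fin 2 // (id : Fin 2 → Fin 2) i = a} F) ℂ).twist χ₂).comp
    (leviProjection F (id : Fin 2 → Fin 2))) (rootDeltaChar (standardParabolicGL F (id : Fin 2 → Fin 2))))),
    (∀ (g : GL (Fin 2) F) (x : (restrictUnipotentGL F (![0, 0, 1] : Fin 3 → Fin 2) (parabolicIndGL F (id : Fin 3 → Fin 3)
    ((Representation.trivial ℂ (Π a : Fin 3, GL {i : Fin 3 // (id : Fin 3 → Fin 3) i = a} F) ℂ).twist χ))).Coinvariants),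
    Ψ (jacquetGL F (![0, 0, 1] : Fin 3 → Fin 2) (parabolicIndGL F (id : Fin 3 → Fin 3)
    ((Representation.trivial ℂ (Π a : Fin 3, GL {i : Fin 3 // (id : Fin 3 → Fin 3) i = a} F) ℂ).twist χ)) (ι g) x) =
    (parabolicIndGL F (id : Fin 2 → Fin 2)
    ((Representation.trivial ℂ (Π a : Fin 2, GL {i : Fin 2 // (id : Fin 2 → Fin 2) i = a} F) ℂ).twist χ₂)) g (Ψ x)) ∧
    ∀ x : (restrictUnipotentGL F (![0, 0, 1] : Fin 3 → Fin 2) (parabolicIndGL F (id : Fin 3 → Fin 3)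
    ((Representation.trivial ℂ (Π a : Fin 3, GL {i : Fin 3 // (id : Fin 3 → Fin 3) i = a} F) ℂ).twist χ))).Coinvariants,
    Ψ x = 0 → ∃ f ∈ vanishingOn (standardParabolicGL F (id : Fin 3 → Fin 3))
    (Representation.twist (((Representation.trivial ℂ (Π a : Fin 3, GL {i : Fin 3 // (id : Fin 3 → Fin 3) i = a} F) ℂ).twist χ).comp
    (leviProjection F (id : Fin 3 → Fin 3))) (rootDeltaChar (standardParabolicGL F (id : Fin 3 → Fin 3))))
    (standardParabolicGL F (![0, 0, 1] : Fin 3 → Fin 2) : Set (GL (Fin 3) F)),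
    Coinvariants.mk (restrictUnipotentGL F (![0, 0, 1] : Fin 3 → Fin 2) (parabolicIndGL F (id : Fin 3 → Fin 3)
    ((Representation.trivial ℂ (Π a : Fin 3, GL {i : Fin 3 // (id : Fin 3 → Fin 3) i = a} F) ℂ).twist χ))) f = x := by
  intro ι hι hιc
  obtain ⟨χ₂, Ψ, -, hΨ, hker⟩ := K2E3GL3BorelInducedJacquetQClosedCellGL2.exists_closedCellMap_blockMap χ ι hι hιc
  exact ⟨χ₂, Ψ, hΨ, fun x hx => (hker x).1 hx⟩

/-- **The weak cell lemma for `P_{(2,1)}` modulo the two analytic letters**: L1 (middle cell: `Ψ₁` on `J_P`, `GL₂`-equivariant, `ker Ψ₁ ⊆ J_Z`) and L2 (open cell: `Ψ₂` on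
`J_Z`, `GL₂`-equivariant, injective) give ★ E4a's `h3cell` body at `c = ![0,0,1]` (★ E4b-3 with L0 discharged by `closedCell_letter`).
[cite: BernsteinZelevinsky1977, Thm. 5.2, §2.3] [cite: Casselman1995, Cor. 5.4.3, §6.3] -/
theorem ncq_jacquetGL_twoOne_of_middle_of_open (χ : (Π a : Fin 3, GL {i : Fin 3 // (id : Fin 3 → Fin 3) i = a} F) →* ℂˣ)
    (h1 : ∀ ι : GL (Fin 2) F →* (Π a, GL {i // (![0, 0, 1] : Fin 3 → Fin 2) i = a} F),
      (∀ g : GL (Fin 2) F, ((blockDiagonalGL F (![0, 0, 1] : Fin 3 → Fin 2) (ι g) : GL (Fin 3) F) : Matrix (Fin 3) (Fin 3) F) =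
          !![(g : Matrix (Fin 2) (Fin 2) F) 0 0, (g : Matrix (Fin 2) (Fin 2) F) 0 1, 0;
             (g : Matrix (Fin 2) (Fin 2) F) 1 0, (g : Matrix (Fin 2) (Fin 2) F) 1 1, 0;
             0, 0, 1]) → Continuous ι →
      ∀ J₁ : Subrepresentation (jacquetGL F (![0, 0, 1] : Fin 3 → Fin 2) (parabolicIndGL F (id : Fin 3 → Fin 3)
          ((Representation.trivial ℂ (Π a : Fin 3, GL {i : Fin 3 // (id : Fin 3 → Fin 3) i = a} F) ℂ).twist χ))),
        (∀ x, x ∈ J₁ ↔ ∃ f ∈ vanishingOn (standardParabolicGL F (id : Fin 3 → Fin 3))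
            (Representation.twist (((Representation.trivial ℂ (Π a : Fin 3, GL {i : Fin 3 // (id : Fin 3 → Fin 3) i = a} F) ℂ).twist χ).comp
              (leviProjection F (id : Fin 3 → Fin 3))) (rootDeltaChar (standardParabolicGL F (id : Fin 3 → Fin 3))))
            (standardParabolicGL F (![0, 0, 1] : Fin 3 → Fin 2) : Set (GL (Fin 3) F)),
            Coinvariants.mk (restrictUnipotentGL F (![0, 0, 1] : Fin 3 → Fin 2) (parabolicIndGL F (id : Fin 3 → Fin 3)
              ((Representation.trivial ℂ (Π a : Fin 3, GL {i : Fin 3 // (id : Fin 3 → Fin 3) i = a} F) ℂ).twist χ))) f = x) →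
        ∃ (χ₂ : (Π a : Fin 2, GL {i : Fin 2 // (id : Fin 2 → Fin 2) i = a} F) →* ℂˣ)
          (Ψ : J₁.toSubmodule →ₗ[ℂ]
            SmoothInd (standardParabolicGL F (id : Fin 2 → Fin 2))
              (Representation.twist (((Representation.trivial ℂ (Π a : Fin 2, GL {i : Fin 2 // (id : Fin 2 → Fin 2) i = a} F) ℂ).twist χ₂).comp
                (leviProjection F (id : Fin 2 → Fin 2))) (rootDeltaChar (standardParabolicGL F (id : Fin 2 → Fin 2))))),
          (∀ (g : GL (Fin 2) F) (a : J₁.toSubmodule),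
            Ψ ⟨jacquetGL F (![0, 0, 1] : Fin 3 → Fin 2) (parabolicIndGL F (id : Fin 3 → Fin 3)
              ((Representation.trivial ℂ (Π a : Fin 3, GL {i : Fin 3 // (id : Fin 3 → Fin 3) i = a} F) ℂ).twist χ)) (ι g)
                (a : (restrictUnipotentGL F (![0, 0, 1] : Fin 3 → Fin 2) (parabolicIndGL F (id : Fin 3 → Fin 3)
                  ((Representation.trivial ℂ (Π a : Fin 3, GL {i : Fin 3 // (id : Fin 3 → Fin 3) i = a} F) ℂ).twist χ))).Coinvariants),
              J₁.apply_mem_toSubmodule (ι g) a.2⟩ =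
            (parabolicIndGL F (id : Fin 2 → Fin 2)
              ((Representation.trivial ℂ (Π a : Fin 2, GL {i : Fin 2 // (id : Fin 2 → Fin 2) i = a} F) ℂ).twist χ₂)) g (Ψ a)) ∧
          ∀ a : J₁.toSubmodule, Ψ a = 0 → ∃ f ∈ vanishingOn (standardParabolicGL F (id : Fin 3 → Fin 3))
            (Representation.twist (((Representation.trivial ℂ (Π a : Fin 3, GL {i : Fin 3 // (id : Fin 3 → Fin 3) i = a} F) ℂ).twist χ).comp
              (leviProjection F (id : Fin 3 → Fin 3))) (rootDeltaChar (standardParabolicGL F (id : Fin 3 → Fin 3))))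
            {g : GL (Fin 3) F | (g : Matrix (Fin 3) (Fin 3) F) 1 0 * (g : Matrix (Fin 3) (Fin 3) F) 2 1 -
              (g : Matrix (Fin 3) (Fin 3) F) 1 1 * (g : Matrix (Fin 3) (Fin 3) F) 2 0 = 0},
            Coinvariants.mk (restrictUnipotentGL F (![0, 0, 1] : Fin 3 → Fin 2) (parabolicIndGL F (id : Fin 3 → Fin 3)
              ((Representation.trivial ℂ (Π a : Fin 3, GL {i : Fin 3 // (id : Fin 3 → Fin 3) i = a} F) ℂ).twist χ))) f =
              (a : (restrictUnipotentGL F (![0, 0, 1] : Fin 3 → Fin 2) (parabolicIndGL F (id : Fin 3 → Fin 3)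
                ((Representation.trivial ℂ (Π a : Fin 3, GL {i : Fin 3 // (id : Fin 3 → Fin 3) i = a} F) ℂ).twist χ))).Coinvariants))
    (h2 : ∀ ι : GL (Fin 2) F →* (Π a, GL {i // (![0, 0, 1] : Fin 3 → Fin 2) i = a} F),
      (∀ g : GL (Fin 2) F, ((blockDiagonalGL F (![0, 0, 1] : Fin 3 → Fin 2) (ι g) : GL (Fin 3) F) : Matrix (Fin 3) (Fin 3) F) =
          !![(g : Matrix (Fin 2) (Fin 2) F) 0 0, (g : Matrix (Fin 2) (Fin 2) F) 0 1, 0;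
             (g : Matrix (Fin 2) (Fin 2) F) 1 0, (g : Matrix (Fin 2) (Fin 2) F) 1 1, 0;
             0, 0, 1]) → Continuous ι →
      ∀ J₂ : Subrepresentation (jacquetGL F (![0, 0, 1] : Fin 3 → Fin 2) (parabolicIndGL F (id : Fin 3 → Fin 3)
          ((Representation.trivial ℂ (Π a : Fin 3, GL {i : Fin 3 // (id : Fin 3 → Fin 3) i = a} F) ℂ).twist χ))),
        (∀ x, x ∈ J₂ ↔ ∃ f ∈ vanishingOn (standardParabolicGL F (id : Fin 3 → Fin 3))
            (Representation.twist (((Representation.trivial ℂ (Π a : Fin 3, GL {i : Fin 3 // (id : Fin 3 → Fin 3) i = a} F) ℂ).twist χ).comp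
              (leviProjection F (id : Fin 3 → Fin 3))) (rootDeltaChar (standardParabolicGL F (id : Fin 3 → Fin 3))))
            {g : GL (Fin 3) F | (g : Matrix (Fin 3) (Fin 3) F) 1 0 * (g : Matrix (Fin 3) (Fin 3) F) 2 1 -
              (g : Matrix (Fin 3) (Fin 3) F) 1 1 * (g : Matrix (Fin 3) (Fin 3) F) 2 0 = 0},
            Coinvariants.mk (restrictUnipotentGL F (![0, 0, 1] : Fin 3 → Fin 2) (parabolicIndGL F (id : Fin 3 → Fin 3)
              ((Representation.trivial ℂ (Π a : Fin 3, GL {i : Fin 3 // (id : Fin 3 → Fin 3) i = a} F) ℂ).twist χ))) f = x) →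
        ∃ (χ₂ : (Π a : Fin 2, GL {i : Fin 2 // (id : Fin 2 → Fin 2) i = a} F) →* ℂˣ)
          (Ψ : J₂.toSubmodule →ₗ[ℂ]
            SmoothInd (standardParabolicGL F (id : Fin 2 → Fin 2))
              (Representation.twist (((Representation.trivial ℂ (Π a : Fin 2, GL {i : Fin 2 // (id : Fin 2 → Fin 2) i = a} F) ℂ).twist χ₂).comp
                (leviProjection F (id : Fin 2 → Fin 2))) (rootDeltaChar (standardParabolicGL F (id : Fin 2 → Fin 2))))),
          (∀ (g : GL (Fin 2) F) (a : J₂.toSubmodule),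
            Ψ ⟨jacquetGL F (![0, 0, 1] : Fin 3 → Fin 2) (parabolicIndGL F (id : Fin 3 → Fin 3)
              ((Representation.trivial ℂ (Π a : Fin 3, GL {i : Fin 3 // (id : Fin 3 → Fin 3) i = a} F) ℂ).twist χ)) (ι g)
                (a : (restrictUnipotentGL F (![0, 0, 1] : Fin 3 → Fin 2) (parabolicIndGL F (id : Fin 3 → Fin 3)
                  ((Representation.trivial ℂ (Π a : Fin 3, GL {i : Fin 3 // (id : Fin 3 → Fin 3) i = a} F) ℂ).twist χ))).Coinvariants),
              J₂.apply_mem_toSubmodule (ι g) a.2⟩ =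
            (parabolicIndGL F (id : Fin 2 → Fin 2)
              ((Representation.trivial ℂ (Π a : Fin 2, GL {i : Fin 2 // (id : Fin 2 → Fin 2) i = a} F) ℂ).twist χ₂)) g (Ψ a)) ∧
          ∀ a : J₂.toSubmodule, Ψ a = 0 → a = 0) :
    ∀ (W : Type) [AddCommGroup W] [Module ℂ W] (σ : Representation ℂ (Π a : Fin 2, GL {i : Fin 3 // (![0, 0, 1] : Fin 3 → Fin 2) i = a} F) W),
      σ.IsIrreducible → σ.IsSmooth → σ.IsSupercuspidal →
      ∀ (N : Subrepresentation (jacquetGL F (![0, 0, 1] : Fin 3 → Fin 2) (parabolicIndGL F (id : Fin 3 → Fin 3)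
          ((Representation.trivial ℂ (Π a : Fin 3, GL {i : Fin 3 // (id : Fin 3 → Fin 3) i = a} F) ℂ).twist χ))))
        (q : N.toRepresentation.IntertwiningMap σ), q = 0 :=
  ncq_jacquetGL_twoOne_of_cellMaps χ (closedCell_letter χ) h1 h2

/-- **The weak cell lemma for `P_{(1,2)}` modulo the two analytic letters for all `χ′`** (★ E4b-T `ncq_jacquetGL_oneTwo_of_twoOne` applied to
`ncq_jacquetGL_twoOne_of_middle_of_open`). [cite: Zelevinsky1980, §1.1] [cite: BernsteinZelevinsky1977, §2.3, Thm. 5.2] -/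
theorem ncq_jacquetGL_oneTwo_of_middle_of_open
    (h1 : ∀ χ : (Π a : Fin 3, GL {i : Fin 3 // (id : Fin 3 → Fin 3) i = a} F) →* ℂˣ, ∀ ι : GL (Fin 2) F →* (Π a, GL {i // (![0, 0, 1] : Fin 3 → Fin 2) i = a} F),
      (∀ g : GL (Fin 2) F, ((blockDiagonalGL F (![0, 0, 1] : Fin 3 → Fin 2) (ι g) : GL (Fin 3) F) : Matrix (Fin 3) (Fin 3) F) =
      !![(g : Matrix (Fin 2) (Fin 2) F) 0 0, (g : Matrix (Fin 2) (Fin 2) F) 0 1, 0;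
      (g : Matrix (Fin 2) (Fin 2) F) 1 0, (g : Matrix (Fin 2) (Fin 2) F) 1 1, 0;
      0, 0, 1]) → Continuous ι →
      ∀ J₁ : Subrepresentation (jacquetGL F (![0, 0, 1] : Fin 3 → Fin 2) (parabolicIndGL F (id : Fin 3 → Fin 3)
      ((Representation.trivial ℂ (Π a : Fin 3, GL {i : Fin 3 // (id : Fin 3 → Fin 3) i = a} F) ℂ).twist χ))),
      (∀ x, x ∈ J₁ ↔ ∃ f ∈ vanishingOn (standardParabolicGL F (id : Fin 3 → Fin 3))
      (Representation.twist (((Representation.trivial ℂ (Π a : Fin 3, GL {i : Fin 3 // (id : Fin 3 → Fin 3) i = a} F) ℂ).twist χ).comp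
      (leviProjection F (id : Fin 3 → Fin 3))) (rootDeltaChar (standardParabolicGL F (id : Fin 3 → Fin 3))))
      (standardParabolicGL F (![0, 0, 1] : Fin 3 → Fin 2) : Set (GL (Fin 3) F)),
      Coinvariants.mk (restrictUnipotentGL F (![0, 0, 1] : Fin 3 → Fin 2) (parabolicIndGL F (id : Fin 3 → Fin 3)
      ((Representation.trivial ℂ (Π a : Fin 3, GL {i : Fin 3 // (id : Fin 3 → Fin 3) i = a} F) ℂ).twist χ))) f = x) →
      ∃ (χ₂ : (Π a : Fin 2, GL {i : Fin 2 // (id : Fin 2 → Fin 2) i = a} F) →* ℂˣ)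
      (Ψ : J₁.toSubmodule →ₗ[ℂ]
      SmoothInd (standardParabolicGL F (id : Fin 2 → Fin 2))
      (Representation.twist (((Representation.trivial ℂ (Π a : Fin 2, GL {i : Fin 2 // (id : Fin 2 → Fin 2) i = a} F) ℂ).twist χ₂).comp
      (leviProjection F (id : Fin 2 → Fin 2))) (rootDeltaChar (standardParabolicGL F (id : Fin 2 → Fin 2))))),
      (∀ (g : GL (Fin 2) F) (a : J₁.toSubmodule),
      Ψ ⟨jacquetGL F (![0, 0, 1] : Fin 3 → Fin 2) (parabolicIndGL F (id : Fin 3 → Fin 3)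
      ((Representation.trivial ℂ (Π a : Fin 3, GL {i : Fin 3 // (id : Fin 3 → Fin 3) i = a} F) ℂ).twist χ)) (ι g)
      (a : (restrictUnipotentGL F (![0, 0, 1] : Fin 3 → Fin 2) (parabolicIndGL F (id : Fin 3 → Fin 3)
      ((Representation.trivial ℂ (Π a : Fin 3, GL {i : Fin 3 // (id : Fin 3 → Fin 3) i = a} F) ℂ).twist χ))).Coinvariants),
      J₁.apply_mem_toSubmodule (ι g) a.2⟩ =
      (parabolicIndGL F (id : Fin 2 → Fin 2)
      ((Representation.trivial ℂ (Π a : Fin 2, GL {i : Fin 2 // (id : Fin 2 → Fin 2) i = a} F) ℂ).twist χ₂)) g (Ψ a)) ∧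
      ∀ a : J₁.toSubmodule, Ψ a = 0 → ∃ f ∈ vanishingOn (standardParabolicGL F (id : Fin 3 → Fin 3))
      (Representation.twist (((Representation.trivial ℂ (Π a : Fin 3, GL {i : Fin 3 // (id : Fin 3 → Fin 3) i = a} F) ℂ).twist χ).comp
      (leviProjection F (id : Fin 3 → Fin 3))) (rootDeltaChar (standardParabolicGL F (id : Fin 3 → Fin 3))))
      {g : GL (Fin 3) F | (g : Matrix (Fin 3) (Fin 3) F) 1 0 * (g : Matrix (Fin 3) (Fin 3) F) 2 1 -
      (g : Matrix (Fin 3) (Fin 3) F) 1 1 * (g : Matrix (Fin 3) (Fin 3) F) 2 0 = 0},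
      Coinvariants.mk (restrictUnipotentGL F (![0, 0, 1] : Fin 3 → Fin 2) (parabolicIndGL F (id : Fin 3 → Fin 3)
      ((Representation.trivial ℂ (Π a : Fin 3, GL {i : Fin 3 // (id : Fin 3 → Fin 3) i = a} F) ℂ).twist χ))) f =
      (a : (restrictUnipotentGL F (![0, 0, 1] : Fin 3 → Fin 2) (parabolicIndGL F (id : Fin 3 → Fin 3)
      ((Representation.trivial ℂ (Π a : Fin 3, GL {i : Fin 3 // (id : Fin 3 → Fin 3) i = a} F) ℂ).twist χ))).Coinvariants))
    (h2 : ∀ χ : (Π a : Fin 3, GL {i : Fin 3 // (id : Fin 3 → Fin 3) i = a} F) →* ℂˣ, ∀ ι : GL (Fin 2) F →* (Π a, GL {i // (![0, 0, 1] : Fin 3 → Fin 2) i = a} F),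
      (∀ g : GL (Fin 2) F, ((blockDiagonalGL F (![0, 0, 1] : Fin 3 → Fin 2) (ι g) : GL (Fin 3) F) : Matrix (Fin 3) (Fin 3) F) =
      !![(g : Matrix (Fin 2) (Fin 2) F) 0 0, (g : Matrix (Fin 2) (Fin 2) F) 0 1, 0;
      (g : Matrix (Fin 2) (Fin 2) F) 1 0, (g : Matrix (Fin 2) (Fin 2) F) 1 1, 0;
      0, 0, 1]) → Continuous ι →
      ∀ J₂ : Subrepresentation (jacquetGL F (![0, 0, 1] : Fin 3 → Fin 2) (parabolicIndGL F (id : Fin 3 → Fin 3)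
      ((Representation.trivial ℂ (Π a : Fin 3, GL {i : Fin 3 // (id : Fin 3 → Fin 3) i = a} F) ℂ).twist χ))),
      (∀ x, x ∈ J₂ ↔ ∃ f ∈ vanishingOn (standardParabolicGL F (id : Fin 3 → Fin 3))
      (Representation.twist (((Representation.trivial ℂ (Π a : Fin 3, GL {i : Fin 3 // (id : Fin 3 → Fin 3) i = a} F) ℂ).twist χ).comp
      (leviProjection F (id : Fin 3 → Fin 3))) (rootDeltaChar (standardParabolicGL F (id : Fin 3 → Fin 3))))
      {g : GL (Fin 3) F | (g : Matrix (Fin 3) (Fin 3) F) 1 0 * (g : Matrix (Fin 3) (Fin 3) F) 2 1 -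
      (g : Matrix (Fin 3) (Fin 3) F) 1 1 * (g : Matrix (Fin 3) (Fin 3) F) 2 0 = 0},
      Coinvariants.mk (restrictUnipotentGL F (![0, 0, 1] : Fin 3 → Fin 2) (parabolicIndGL F (id : Fin 3 → Fin 3)
      ((Representation.trivial ℂ (Π a : Fin 3, GL {i : Fin 3 // (id : Fin 3 → Fin 3) i = a} F) ℂ).twist χ))) f = x) →
      ∃ (χ₂ : (Π a : Fin 2, GL {i : Fin 2 // (id : Fin 2 → Fin 2) i = a} F) →* ℂˣ)
      (Ψ : J₂.toSubmodule →ₗ[ℂ]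
      SmoothInd (standardParabolicGL F (id : Fin 2 → Fin 2))
      (Representation.twist (((Representation.trivial ℂ (Π a : Fin 2, GL {i : Fin 2 // (id : Fin 2 → Fin 2) i = a} F) ℂ).twist χ₂).comp
      (leviProjection F (id : Fin 2 → Fin 2))) (rootDeltaChar (standardParabolicGL F (id : Fin 2 → Fin 2))))),
      (∀ (g : GL (Fin 2) F) (a : J₂.toSubmodule),
      Ψ ⟨jacquetGL F (![0, 0, 1] : Fin 3 → Fin 2) (parabolicIndGL F (id : Fin 3 → Fin 3)
      ((Representation.trivial ℂ (Π a : Fin 3, GL {i : Fin 3 // (id : Fin 3 → Fin 3) i = a} F) ℂ).twist χ)) (ι g)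
      (a : (restrictUnipotentGL F (![0, 0, 1] : Fin 3 → Fin 2) (parabolicIndGL F (id : Fin 3 → Fin 3)
      ((Representation.trivial ℂ (Π a : Fin 3, GL {i : Fin 3 // (id : Fin 3 → Fin 3) i = a} F) ℂ).twist χ))).Coinvariants),
      J₂.apply_mem_toSubmodule (ι g) a.2⟩ =
      (parabolicIndGL F (id : Fin 2 → Fin 2)
      ((Representation.trivial ℂ (Π a : Fin 2, GL {i : Fin 2 // (id : Fin 2 → Fin 2) i = a} F) ℂ).twist χ₂)) g (Ψ a)) ∧
      ∀ a : J₂.toSubmodule, Ψ a = 0 → a = 0)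
    (χ : (Π a : Fin 3, GL {i : Fin 3 // (id : Fin 3 → Fin 3) i = a} F) →* ℂˣ) :
    ∀ (W : Type) [AddCommGroup W] [Module ℂ W] (σ : Representation ℂ (Π a : Fin 2, GL {i : Fin 3 // (![0, 1, 1] : Fin 3 → Fin 2) i = a} F) W),
      σ.IsIrreducible → σ.IsSmooth → σ.IsSupercuspidal →
      ∀ (N : Subrepresentation (jacquetGL F (![0, 1, 1] : Fin 3 → Fin 2) (parabolicIndGL F (id : Fin 3 → Fin 3)
          ((Representation.trivial ℂ (Π a : Fin 3, GL {i : Fin 3 // (id : Fin 3 → Fin 3) i = a} F) ℂ).twist χ))))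
        (q : N.toRepresentation.IntertwiningMap σ), q = 0 := by
  intro W _ _ σ hirr hsm hsc N q
  haveI := hirr
  exact K2E3GL3WeakCellLemmaTransport.ncq_jacquetGL_oneTwo_of_twoOne F
    (fun χ' σ' h₁ h₂ h₃ N' q' => ncq_jacquetGL_twoOne_of_middle_of_open χ' (h1 χ') (h2 χ') W σ' h₁ h₂ h₃ N' q') χ σ hsm hsc N q

/-- **THE SOCKET `sig_K2E3GL3PrincipalSeriesThreeCell` (★ E4a's `h3cell`, χ-form) MODULO THE TWO ANALYTIC CELL LETTERS L1, L2** (for all torus characters): both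
two-block parabolics of `GL₃(F)` — `P_{(2,1)}` by the dévissage of ★ E4b-3, `P_{(1,2)}` by ★ E4b-T — glued by ★ `h3cell_of_twoOne_of_oneTwo`.  The statement after the
colon is the socket's body for the field `F` (ED. 2 closes the letters and ∀-closes over `F`).
[cite: BernsteinZelevinsky1977, Thm. 5.2] [cite: Casselman1995, Cor. 5.4.3, §6.3] -/
theorem principalSeriesThreeCell_of_middle_of_open
    (h1 : ∀ χ : (Π a : Fin 3, GL {i : Fin 3 // (id : Fin 3 → Fin 3) i = a} F) →* ℂˣ, ∀ ι : GL (Fin 2) F →* (Π a, GL {i // (![0, 0, 1] : Fin 3 → Fin 2) i = a} F),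
      (∀ g : GL (Fin 2) F, ((blockDiagonalGL F (![0, 0, 1] : Fin 3 → Fin 2) (ι g) : GL (Fin 3) F) : Matrix (Fin 3) (Fin 3) F) =
      !![(g : Matrix (Fin 2) (Fin 2) F) 0 0, (g : Matrix (Fin 2) (Fin 2) F) 0 1, 0;
      (g : Matrix (Fin 2) (Fin 2) F) 1 0, (g : Matrix (Fin 2) (Fin 2) F) 1 1, 0;
      0, 0, 1]) → Continuous ι →
      ∀ J₁ : Subrepresentation (jacquetGL F (![0, 0, 1] : Fin 3 → Fin 2) (parabolicIndGL F (id : Fin 3 → Fin 3)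
      ((Representation.trivial ℂ (Π a : Fin 3, GL {i : Fin 3 // (id : Fin 3 → Fin 3) i = a} F) ℂ).twist χ))),
      (∀ x, x ∈ J₁ ↔ ∃ f ∈ vanishingOn (standardParabolicGL F (id : Fin 3 → Fin 3))
      (Representation.twist (((Representation.trivial ℂ (Π a : Fin 3, GL {i : Fin 3 // (id : Fin 3 → Fin 3) i = a} F) ℂ).twist χ).comp
      (leviProjection F (id : Fin 3 → Fin 3))) (rootDeltaChar (standardParabolicGL F (id : Fin 3 → Fin 3))))
      (standardParabolicGL F (![0, 0, 1] : Fin 3 → Fin 2) : Set (GL (Fin 3) F)),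
      Coinvariants.mk (restrictUnipotentGL F (![0, 0, 1] : Fin 3 → Fin 2) (parabolicIndGL F (id : Fin 3 → Fin 3)
      ((Representation.trivial ℂ (Π a : Fin 3, GL {i : Fin 3 // (id : Fin 3 → Fin 3) i = a} F) ℂ).twist χ))) f = x) →
      ∃ (χ₂ : (Π a : Fin 2, GL {i : Fin 2 // (id : Fin 2 → Fin 2) i = a} F) →* ℂˣ)
      (Ψ : J₁.toSubmodule →ₗ[ℂ]
      SmoothInd (standardParabolicGL F (id : Fin 2 → Fin 2))
      (Representation.twist (((Representation.trivial ℂ (Π a : Fin 2, GL {i : Fin 2 // (id : Fin 2 → Fin 2) i = a} F) ℂ).twist χ₂).comp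
      (leviProjection F (id : Fin 2 → Fin 2))) (rootDeltaChar (standardParabolicGL F (id : Fin 2 → Fin 2))))),
      (∀ (g : GL (Fin 2) F) (a : J₁.toSubmodule),
      Ψ ⟨jacquetGL F (![0, 0, 1] : Fin 3 → Fin 2) (parabolicIndGL F (id : Fin 3 → Fin 3)
      ((Representation.trivial ℂ (Π a : Fin 3, GL {i : Fin 3 // (id : Fin 3 → Fin 3) i = a} F) ℂ).twist χ)) (ι g)
      (a : (restrictUnipotentGL F (![0, 0, 1] : Fin 3 → Fin 2) (parabolicIndGL F (id : Fin 3 → Fin 3)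
      ((Representation.trivial ℂ (Π a : Fin 3, GL {i : Fin 3 // (id : Fin 3 → Fin 3) i = a} F) ℂ).twist χ))).Coinvariants),
      J₁.apply_mem_toSubmodule (ι g) a.2⟩ =
      (parabolicIndGL F (id : Fin 2 → Fin 2)
      ((Representation.trivial ℂ (Π a : Fin 2, GL {i : Fin 2 // (id : Fin 2 → Fin 2) i = a} F) ℂ).twist χ₂)) g (Ψ a)) ∧
      ∀ a : J₁.toSubmodule, Ψ a = 0 → ∃ f ∈ vanishingOn (standardParabolicGL F (id : Fin 3 → Fin 3))
      (Representation.twist (((Representation.trivial ℂ (Π a : Fin 3, GL {i : Fin 3 // (id : Fin 3 → Fin 3) i = a} F) ℂ).twist χ).comp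
      (leviProjection F (id : Fin 3 → Fin 3))) (rootDeltaChar (standardParabolicGL F (id : Fin 3 → Fin 3))))
      {g : GL (Fin 3) F | (g : Matrix (Fin 3) (Fin 3) F) 1 0 * (g : Matrix (Fin 3) (Fin 3) F) 2 1 -
      (g : Matrix (Fin 3) (Fin 3) F) 1 1 * (g : Matrix (Fin 3) (Fin 3) F) 2 0 = 0},
      Coinvariants.mk (restrictUnipotentGL F (![0, 0, 1] : Fin 3 → Fin 2) (parabolicIndGL F (id : Fin 3 → Fin 3)
      ((Representation.trivial ℂ (Π a : Fin 3, GL {i : Fin 3 // (id : Fin 3 → Fin 3) i = a} F) ℂ).twist χ))) f =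
      (a : (restrictUnipotentGL F (![0, 0, 1] : Fin 3 → Fin 2) (parabolicIndGL F (id : Fin 3 → Fin 3)
      ((Representation.trivial ℂ (Π a : Fin 3, GL {i : Fin 3 // (id : Fin 3 → Fin 3) i = a} F) ℂ).twist χ))).Coinvariants))
    (h2 : ∀ χ : (Π a : Fin 3, GL {i : Fin 3 // (id : Fin 3 → Fin 3) i = a} F) →* ℂˣ, ∀ ι : GL (Fin 2) F →* (Π a, GL {i // (![0, 0, 1] : Fin 3 → Fin 2) i = a} F),
      (∀ g : GL (Fin 2) F, ((blockDiagonalGL F (![0, 0, 1] : Fin 3 → Fin 2) (ι g) : GL (Fin 3) F) : Matrix (Fin 3) (Fin 3) F) =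
      !![(g : Matrix (Fin 2) (Fin 2) F) 0 0, (g : Matrix (Fin 2) (Fin 2) F) 0 1, 0;
      (g : Matrix (Fin 2) (Fin 2) F) 1 0, (g : Matrix (Fin 2) (Fin 2) F) 1 1, 0;
      0, 0, 1]) → Continuous ι →
      ∀ J₂ : Subrepresentation (jacquetGL F (![0, 0, 1] : Fin 3 → Fin 2) (parabolicIndGL F (id : Fin 3 → Fin 3)
      ((Representation.trivial ℂ (Π a : Fin 3, GL {i : Fin 3 // (id : Fin 3 → Fin 3) i = a} F) ℂ).twist χ))),
      (∀ x, x ∈ J₂ ↔ ∃ f ∈ vanishingOn (standardParabolicGL F (id : Fin 3 → Fin 3))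
      (Representation.twist (((Representation.trivial ℂ (Π a : Fin 3, GL {i : Fin 3 // (id : Fin 3 → Fin 3) i = a} F) ℂ).twist χ).comp
      (leviProjection F (id : Fin 3 → Fin 3))) (rootDeltaChar (standardParabolicGL F (id : Fin 3 → Fin 3))))
      {g : GL (Fin 3) F | (g : Matrix (Fin 3) (Fin 3) F) 1 0 * (g : Matrix (Fin 3) (Fin 3) F) 2 1 -
      (g : Matrix (Fin 3) (Fin 3) F) 1 1 * (g : Matrix (Fin 3) (Fin 3) F) 2 0 = 0},
      Coinvariants.mk (restrictUnipotentGL F (![0, 0, 1] : Fin 3 → Fin 2) (parabolicIndGL F (id : Fin 3 → Fin 3)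
      ((Representation.trivial ℂ (Π a : Fin 3, GL {i : Fin 3 // (id : Fin 3 → Fin 3) i = a} F) ℂ).twist χ))) f = x) →
      ∃ (χ₂ : (Π a : Fin 2, GL {i : Fin 2 // (id : Fin 2 → Fin 2) i = a} F) →* ℂˣ)
      (Ψ : J₂.toSubmodule →ₗ[ℂ]
      SmoothInd (standardParabolicGL F (id : Fin 2 → Fin 2))
      (Representation.twist (((Representation.trivial ℂ (Π a : Fin 2, GL {i : Fin 2 // (id : Fin 2 → Fin 2) i = a} F) ℂ).twist χ₂).comp
      (leviProjection F (id : Fin 2 → Fin 2))) (rootDeltaChar (standardParabolicGL F (id : Fin 2 → Fin 2))))),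
      (∀ (g : GL (Fin 2) F) (a : J₂.toSubmodule),
      Ψ ⟨jacquetGL F (![0, 0, 1] : Fin 3 → Fin 2) (parabolicIndGL F (id : Fin 3 → Fin 3)
      ((Representation.trivial ℂ (Π a : Fin 3, GL {i : Fin 3 // (id : Fin 3 → Fin 3) i = a} F) ℂ).twist χ)) (ι g)
      (a : (restrictUnipotentGL F (![0, 0, 1] : Fin 3 → Fin 2) (parabolicIndGL F (id : Fin 3 → Fin 3)
      ((Representation.trivial ℂ (Π a : Fin 3, GL {i : Fin 3 // (id : Fin 3 → Fin 3) i = a} F) ℂ).twist χ))).Coinvariants),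
      J₂.apply_mem_toSubmodule (ι g) a.2⟩ =
      (parabolicIndGL F (id : Fin 2 → Fin 2)
      ((Representation.trivial ℂ (Π a : Fin 2, GL {i : Fin 2 // (id : Fin 2 → Fin 2) i = a} F) ℂ).twist χ₂)) g (Ψ a)) ∧
      ∀ a : J₂.toSubmodule, Ψ a = 0 → a = 0)
    (χ : (Π a : Fin 3, GL {i : Fin 3 // (id : Fin 3 → Fin 3) i = a} F) →* ℂˣ) :
    ∀ c : Fin 3 → Fin 2, Monotone c → Function.Surjective c →
      ∀ (W : Type) [AddCommGroup W] [Module ℂ W] (σ : Representation ℂ (Π a : Fin 2, GL {i : Fin 3 // c i = a} F) W),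
        σ.IsIrreducible → σ.IsSmooth → σ.IsSupercuspidal →
        ∀ (N : Subrepresentation (Representation.jacquetGL F c (Representation.parabolicIndGL F (id : Fin 3 → Fin 3)
            ((Representation.trivial ℂ (Π a : Fin 3, GL {i : Fin 3 // (id : Fin 3 → Fin 3) i = a} F) ℂ).twist χ))))
          (q : N.toRepresentation.IntertwiningMap σ), q = 0 :=
  h3cell_of_twoOne_of_oneTwo χ (ncq_jacquetGL_twoOne_of_middle_of_open χ (h1 χ) (h2 χ)) (ncq_jacquetGL_oneTwo_of_middle_of_open h1 h2 χ)

/-! ## ED. 2 — the letter-free payer of the socket `sig_K2E3GL3PrincipalSeriesThreeCell` -/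

/-- **THE WEAK 3-CELL LEMMA `sig_K2E3GL3PrincipalSeriesThreeCell` (★ E4a's binder `h3cell`, χ-form), SORRY-FREE, BOTH TWO-BLOCK PARABOLICS OF `GL₃(F)`**: for every
character `χ` of the diagonal torus, every monotone surjective `c : Fin 3 → Fin 2`, every irreducible smooth supercuspidal representation `σ` of the Levi `M_c`, every
`M_c`-subrepresentation `N` of the Jacquet module `r_c(Ind_B^{GL₃} χδ_B^{1/2})` and every `M_c`-map `q : N → σ`: `q = 0` — ED. 1's `principalSeriesThreeCell_of_middle_of_open`
with its two analytic letters PAID BY NAME: L1 = ★ (E4b-1β) `K2E3GL3BorelInducedJacquetQMiddleCell.exists_middleCellMap` (K2E3-p21 (g7)), L2 = ★ (E4b-1γ)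
`K2E3GL3BorelInducedJacquetQOpenCell.openCell_letter` (K2E3-p25 (g2)).  Statement = the socket's bytes (U12 ED. 31 :479–:486) token for token.
[cite: BernsteinZelevinsky1977, Thm. 5.2, §2.3] [cite: Casselman1995, Cor. 5.4.3, §6.3, Prop. 6.3.1] [cite: Zelevinsky1980, §1.1] -/
theorem principalSeriesThreeCell : ∀ (F : Type) [Field F] [ValuativeRel F] [TopologicalSpace F] [IsNonarchimedeanLocalField F] [CharZero F]
    (χ : (Π a : Fin 3, GL {i : Fin 3 // (id : Fin 3 → Fin 3) i = a} F) →* ℂˣ),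
    ∀ c : Fin 3 → Fin 2, Monotone c → Function.Surjective c →
      ∀ (W : Type) [AddCommGroup W] [Module ℂ W] (σ : Representation ℂ (Π a : Fin 2, GL {i : Fin 3 // c i = a} F) W),
        σ.IsIrreducible → σ.IsSmooth → σ.IsSupercuspidal →
        ∀ (N : Subrepresentation (Representation.jacquetGL F c (Representation.parabolicIndGL F (id : Fin 3 → Fin 3)
            ((Representation.trivial ℂ (Π a : Fin 3, GL {i : Fin 3 // (id : Fin 3 → Fin 3) i = a} F) ℂ).twist χ))))
          (q : N.toRepresentation.IntertwiningMap σ), q = 0 :=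
  fun F _ _ _ _ _ χ => principalSeriesThreeCell_of_middle_of_open (F := F)
    (fun χ' => K2E3GL3BorelInducedJacquetQMiddleCell.exists_middleCellMap χ')
    (fun χ' => K2E3GL3BorelInducedJacquetQOpenCell.openCell_letter χ') χ

end Summit.HodgeConjecture.HodgeConjecture.Cruxes.H413.K2E3GL3PrincipalSeriesThreeCell

end
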